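import Summits.QuantumFields.YangMills.Theorems.UnitScaleTiltProp7IterLambdaBound
import Summits.QuantumFields.YangMills.Theorems.UnitScaleTiltProp7OneStepL2BoundsT3
import HarnessLib

/-!
# Route `UnitScaleTilt`, crux K1 «MinimiserStabilityRegPr» (stmt-QuantumFields-19200), LANE II (QH1)♮ — (S-LEGS-flat):
# THE CENTRE-STAIR LEGS OF THE TRUE LINEARISED AVERAGE `Q^{E′}(1)` ARE `ℓ²`-BOUNDED BY `CΛ·ℓ·(gradient energy)`, `CΛ` L-ONLY

Cell `ym3-torus`, width seat `ym3-torus-px22` (gen 6).  THEOREMS ONLY (0 `def`, 0 `sorry`); `--supports stmt-QuantumFields-19200 --as helper`,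
count-neutral.  YM₃ on T³ is a ladder rung (R3) — NOT d = 4, NOT infinite volume, NOT a mass gap, NOT the Clay problem; nothing here claims a stub,
the crux or the gap.

THE POINT (★p1 g19 LANE II NAMER WORD №11, px22 g6 LOCATE «(QH1) pencil» (P3)∕§3).  At the flat member the true linearised k-fold average splits as
`Q^{E′}(1) Y = Lᵏ•Q_k Y − ∇Λ_k Y` (✓`ChartHInv.linFamily_eq_sub_comb`, `Q_k = bondAvgIter k` the honest straight average, `Λ` the comb family
`Λ₀ = 0`, `Λ_{i+1}(Y)(y) = Lⁱ•combMean(Q_iY)(y) + Λ_i(Y)(emb y)` of ✓`Prop8ChartHInvComb.exists_combFamily`).  The tube part is an `ℓ`-normalised contraction;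
the centre-stair legs `∇Λ_k` are NOT `ℓ²`-bounded K-uniformly (op-norm² ≈ 3.1·ℓ: point sampling on gauge directions) but they ARE bounded by the
GRADIENT ENERGY with an L-only constant times `ℓ = Lᵏ` — the `H¹` row the (QH1)♮ knit needs for its `Q^{E′}` piece.  The per-block `(H¹)^*` bound is
ALREADY in the tree (★p1 g11 route-R N6: ✓`Prop7IterLambdaBound.norm_sq_iterLambda_le`, d = 3, GEOMETRIC level sum — no log); this file is the coarse-gradient
∕ block-sum knit to the row shape of px19 g6's `rlegs_flat`.

* §1 `sum_blockEnergy_le_energy` — summing the interior gradient energies of the k-blocks gives at most the total gradient energy.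
* §2 ★ `slegs_flat` (generic `P : Params` with `d = 3`, `M_N(ℂ)`-valued fields): `Σ_{c : PBond P k} ‖Λ_k Y c₊ − Λ_k Y c₋‖² ≤ 4d·c₂(L)·Lᵏ·Σ_{μ ν x} ‖Y(x+e_ν, μ) − Y(x, μ)‖²`,
  `c₂(L) = ((d+2)L)²·N·L²∕(√L − 1)²` — via ✓`Prop7OneStepL2Bounds.sum_norm_sq_coarseGrad_le` (px6) ∘ ✓`norm_sq_iterLambda_le` (p1) ∘ §1.
* §3 ★★ `slegs_flat_T3` — the member reading on the T³ family in (R-LEGS-flat)'s binder order: `∀ L > 1, ∃ CΛ ≥ 0, ∀ F (F.L = L) n K (n ≤ K) X Λ, …`.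

HONEST SCOPE.  Flat background, linear bookkeeping over two landed theorems; nothing of (QH1)♮ at a curved `W`, (REC), `hN06`, EX or the crux is proved here.

References: T. Bałaban, CMP 95 (1984) 17–40 [Balaban1984PropagatorsI] ((1.4) p.18, (1.18)–(1.20) pp.19–20); CMP 98 (1985) 17–51 [Balaban1985Averaging]
((62) p.28, (124)–(125) p.36); CMP 102 (1985) 277–309 [Balaban1985Variational] (Prop. 7 p.299).
-/

noncomputable section

open scoped BigOperators Matrix.Norms.L2Operator Matrix

namespace Summit.QuantumFields.YangMills.Theorems.Prop7CentreStairLegsFlat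

open Literature.MathematicalPhysics.QuantumFieldTheory.Balaban1983to89
open Finset T4Continuum BlockAveraging BlockAveragingEMLLinearised LatticeFieldCalculus
open Summit.QuantumFields.YangMills.Theorems.Prop7IterLambdaBound (norm_sq_iterLambda_le)
open Summit.QuantumFields.YangMills.Theorems.Prop7OneStepL2Bounds (sum_norm_sq_coarseGrad_le)

variable {P : Params} {N : ℕ} [NeZero N]

/-! ## §1 Summing the block energies -/

omit [NeZero N] in
/-- **BLOCK ENERGIES SUM TO AT MOST THE TOTAL ENERGY**: the interior gradient energies of the k-blocks (the indicator sums of ✓`norm_sq_iterLambda_le`)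
add up, over the k-sites `y`, to at most `Σ_{μ ν x} ‖Y(x+e_ν, μ) − Y(x, μ)‖²` (the blocks partition the fine sites and the interior indicator is ≤ 1).
[cite: Balaban1984PropagatorsI, (1.4) p.18] -/
theorem sum_blockEnergy_le_energy (Y : PBond P 0 → Matrix (Fin N) (Fin N) ℂ) (k : ℕ) :
    ∑ y : Site P k, ∑ μ : Fin P.d, ∑ ν : Fin P.d, ∑ x ∈ univ.filter (fun x : Site P 0 => Site.proj k k x = y),
        (if Site.proj k k (x.shift ν) = y then ‖Y ⟨x.shift ν, μ⟩ - Y ⟨x, μ⟩‖ ^ 2 else 0)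
      ≤ ∑ μ : Fin P.d, ∑ ν : Fin P.d, ∑ x : Site P 0, ‖Y ⟨x.shift ν, μ⟩ - Y ⟨x, μ⟩‖ ^ 2 := by
  classical
  rw [Finset.sum_comm]
  refine Finset.sum_le_sum fun μ _ => ?_
  rw [Finset.sum_comm]
  refine Finset.sum_le_sum fun ν _ => ?_
  calc ∑ y : Site P k, ∑ x ∈ univ.filter (fun x : Site P 0 => Site.proj k k x = y),
          (if Site.proj k k (x.shift ν) = y then ‖Y ⟨x.shift ν, μ⟩ - Y ⟨x, μ⟩‖ ^ 2 else 0)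
      ≤ ∑ y : Site P k, ∑ x ∈ univ.filter (fun x : Site P 0 => Site.proj k k x = y), ‖Y ⟨x.shift ν, μ⟩ - Y ⟨x, μ⟩‖ ^ 2 := by
        refine Finset.sum_le_sum fun y _ => Finset.sum_le_sum fun x _ => ?_
        split_ifs
        · exact le_rfl
        · positivity
    _ = ∑ x : Site P 0, ‖Y ⟨x.shift ν, μ⟩ - Y ⟨x, μ⟩‖ ^ 2 :=
        Finset.sum_fiberwise (s := (univ : Finset (Site P 0))) (g := fun x : Site P 0 => Site.proj k k x)
          (f := fun x : Site P 0 => ‖Y ⟨x.shift ν, μ⟩ - Y ⟨x, μ⟩‖ ^ 2)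

/-! ## §2 ★ The centre-stair legs in `ℓ²`, generic torus -/

/-- ★ **(S-LEGS-flat), generic**: for every comb recursion family `Λ` (`Λ₀ = 0`, `Λ_{i+1}(Y)(y) = Lⁱ•combMean(Q_iY)(y) + Λ_i(Y)(emb y)`), `d = 3`, `k ≤ m + K`:
`Σ_{c : PBond P k} ‖Λ_k(Y)(c₊) − Λ_k(Y)(c₋)‖² ≤ 4d · ((d+2)L)²·N·L²·(Lᵏ∕(√L−1)²) · Σ_{μ ν x} ‖Y(x+e_ν, μ) − Y(x, μ)‖²` — the coarse gradient of the comb gauge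
function costs `ℓ = Lᵏ` times the gradient energy with an L-ONLY constant (geometric level sum: no `k`, no volume).
[cite: Balaban1984PropagatorsI, (1.18)-(1.20) pp.19-20; Balaban1985Averaging, (62) p.28, (124)-(125) p.36] -/
theorem slegs_flat (hd : P.d = 3) (Y : PBond P 0 → Matrix (Fin N) (Fin N) ℂ)
    (Λ : (k : ℕ) → Site P k → Matrix (Fin N) (Fin N) ℂ) (hΛ0 : ∀ y, Λ 0 y = 0)
    (hΛs : ∀ (k : ℕ) (y : Site P (k + 1)), Λ (k + 1) y = (P.L ^ k : ℕ) • combMean (bondAvgIter k Y) y + Λ k (emb y))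
    {k : ℕ} (hk : k ≤ P.m + P.K) :
    ∑ c : PBond P k, ‖Λ k c.tgt - Λ k c.src‖ ^ 2
      ≤ 4 * (P.d : ℝ) * (((((P.d + 2) * P.L : ℕ) : ℝ) ^ 2 * N * (P.L : ℝ) ^ 2 * ((P.L : ℝ) ^ k / (Real.sqrt P.L - 1) ^ 2))
          * ∑ μ : Fin P.d, ∑ ν : Fin P.d, ∑ x : Site P 0, ‖Y ⟨x.shift ν, μ⟩ - Y ⟨x, μ⟩‖ ^ 2) := by
  set C : ℝ := (((P.d + 2) * P.L : ℕ) : ℝ) ^ 2 * N * (P.L : ℝ) ^ 2 * ((P.L : ℝ) ^ k / (Real.sqrt P.L - 1) ^ 2) with hC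
  have hC0 : 0 ≤ C := by positivity
  have h1 := sum_norm_sq_coarseGrad_le (P := P) (k := k) (Λ k)
  have h2 : ∑ y : Site P k, ‖Λ k y‖ ^ 2
      ≤ C * ∑ y : Site P k, ∑ μ : Fin P.d, ∑ ν : Fin P.d, ∑ x ∈ univ.filter (fun x : Site P 0 => Site.proj k k x = y),
          (if Site.proj k k (x.shift ν) = y then ‖Y ⟨x.shift ν, μ⟩ - Y ⟨x, μ⟩‖ ^ 2 else 0) := by
    rw [Finset.mul_sum]
    exact Finset.sum_le_sum fun y _ => norm_sq_iterLambda_le hd Y Λ hΛ0 hΛs hk y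
  have h3 := sum_blockEnergy_le_energy (P := P) Y k
  have hd0 : 0 ≤ 4 * (P.d : ℝ) := by positivity
  calc ∑ c : PBond P k, ‖Λ k c.tgt - Λ k c.src‖ ^ 2 ≤ 4 * (P.d : ℝ) * ∑ y : Site P k, ‖Λ k y‖ ^ 2 := h1
    _ ≤ 4 * (P.d : ℝ) * (C * ∑ μ : Fin P.d, ∑ ν : Fin P.d, ∑ x : Site P 0, ‖Y ⟨x.shift ν, μ⟩ - Y ⟨x, μ⟩‖ ^ 2) := by
        refine mul_le_mul_of_nonneg_left (h2.trans ?_) hd0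
        exact mul_le_mul_of_nonneg_left h3 hC0

/-! ## §3 ★★ The member reading on the T³ family -/

open Literature.MathematicalPhysics.QuantumFieldTheory.Balaban1983to89.T3ContinuumYM3Torus

omit [NeZero N] in
/-- The gradient energy in the `(μ, ν, x)` and in the `(b, ν)` bookkeeping coincide (`PBond ≃ Site × Fin d`). [cite: Balaban1984PropagatorsI, (1.4) p.18] -/
theorem energy_eq_sum_bond (Y : PBond P 0 → Matrix (Fin N) (Fin N) ℂ) :
    ∑ μ : Fin P.d, ∑ ν : Fin P.d, ∑ x : Site P 0, ‖Y ⟨x.shift ν, μ⟩ - Y ⟨x, μ⟩‖ ^ 2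
      = ∑ b : PBond P 0, ∑ ν : Fin P.d, ‖Y ⟨b.src.shift ν, b.dir⟩ - Y b‖ ^ 2 := by
  have h1 : ∑ b : PBond P 0, ∑ ν : Fin P.d, ‖Y ⟨b.src.shift ν, b.dir⟩ - Y b‖ ^ 2
      = ∑ x : Site P 0, ∑ μ : Fin P.d, ∑ ν : Fin P.d, ‖Y ⟨x.shift ν, μ⟩ - Y ⟨x, μ⟩‖ ^ 2 := by
    rw [← (LatticeFieldCalculus.bondEquiv (P := P) (j := 0)).sum_comp
      (fun b : PBond P 0 => ∑ ν : Fin P.d, ‖Y ⟨b.src.shift ν, b.dir⟩ - Y b‖ ^ 2), Fintype.sum_prod_type]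
    rfl
  rw [h1]
  calc ∑ μ : Fin P.d, ∑ ν : Fin P.d, ∑ x : Site P 0, ‖Y ⟨x.shift ν, μ⟩ - Y ⟨x, μ⟩‖ ^ 2
      = ∑ μ : Fin P.d, ∑ x : Site P 0, ∑ ν : Fin P.d, ‖Y ⟨x.shift ν, μ⟩ - Y ⟨x, μ⟩‖ ^ 2 :=
        Finset.sum_congr rfl fun μ _ => Finset.sum_comm
    _ = ∑ x : Site P 0, ∑ μ : Fin P.d, ∑ ν : Fin P.d, ‖Y ⟨x.shift ν, μ⟩ - Y ⟨x, μ⟩‖ ^ 2 := Finset.sum_comm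

/-- ★★ **(S-LEGS-flat) ON THE T³ FAMILY, IN (R-LEGS-flat)'s BINDER ORDER**: for every `L > 1` there is `CΛ ≥ 0` (L-only: `CΛ = 12·(5L)²·2·L²∕(√L−1)²`) such that for every
member (`F.L = L`, `n ≤ K`, `k := K − n`, `ℓ = Lᵏ`), every direction field `X` and every comb recursion family `Λ` on the finest torus `F.P K`,
`Σ_{c : PBond (F.P K) (K−n)} ‖Λ_{K−n}X(c₊) − Λ_{K−n}X(c₋)‖² ≤ CΛ · L^{K−n} · Σ_b Σ_ν ‖X(b + e_ν) − X(b)‖²` — the `H¹` row of the centre-stair part of `Q^{E′}(1)`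
(`Q^{E′}(1)X = Lᵏ•Q_kX − ∇Λ_kX`, ✓`linFamily_eq_sub_comb`), the `Q^{E′}` piece of the (QH1)♮ knit «2·[H¹ row for `Q^{E′}`] + 2·[(R-LEGS)]».
[cite: Balaban1984PropagatorsI, (1.18)-(1.20) pp.19-20; Balaban1985Averaging, (62) p.28, (124)-(125) p.36; Balaban1985Variational, Prop. 7 p.299] -/
theorem slegs_flat_T3 : ∀ (L : ℕ), 1 < L → ∃ CΛ : ℝ, 0 ≤ CΛ ∧
    ∀ (F : T3Family), F.L = L → ∀ (n K : ℕ), n ≤ K → ∀ (X : PBond (F.P K) 0 → Matrix (Fin 2) (Fin 2) ℂ)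
      (Λ : (k : ℕ) → Site (F.P K) k → Matrix (Fin 2) (Fin 2) ℂ), (∀ y, Λ 0 y = 0) →
      (∀ (k : ℕ) (y : Site (F.P K) (k + 1)), Λ (k + 1) y = ((F.P K).L ^ k : ℕ) • combMean (bondAvgIter k X) y + Λ k (emb y)) →
      ∑ c : PBond (F.P K) (K - n), ‖Λ (K - n) c.tgt - Λ (K - n) c.src‖ ^ 2
        ≤ CΛ * (F.L : ℝ) ^ (K - n) * ∑ b : PBond (F.P K) 0, ∑ ν : Fin (F.P K).d, ‖X ⟨b.src.shift ν, b.dir⟩ - X b‖ ^ 2 := by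
  intro L hL
  refine ⟨4 * (3 : ℝ) * ((((3 + 2) * L : ℕ) : ℝ) ^ 2 * (2 : ℕ) * (L : ℝ) ^ 2 / (Real.sqrt L - 1) ^ 2), by positivity, ?_⟩
  intro F hFL n K hnK X Λ hΛ0 hΛs
  subst hFL
  have hd : (F.P K).d = 3 := rfl
  have hk : K - n ≤ (F.P K).m + (F.P K).K := by
    show K - n ≤ F.m + K
    omega
  have h := slegs_flat (P := F.P K) (N := 2) hd X Λ hΛ0 hΛs hk
  rw [energy_eq_sum_bond] at h
  refine h.trans (le_of_eq ?_)
  have hPL : ((F.P K).L : ℝ) = (F.L : ℝ) := rfl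
  have hPd : ((F.P K).d : ℝ) = 3 := by rw [hd]; norm_num
  push_cast
  rw [hPd, hPL]
  ring

end Summit.QuantumFields.YangMills.Theorems.Prop7CentreStairLegsFlat

end
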